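import Literature.AnabelianGeometry.EtaleTheta.TemperedFrobenioidOfKummerTateTower
import Literature.AnabelianGeometry.EtaleTheta.Discharge.Sec3EffRealSpanTateTowerKummer
import Literature.AnabelianGeometry.EtaleTheta.Discharge.Sec3Cor38iiiKnitRankOnePointTateTower
import HarnessLib

/-!
# [EtTh] Prop. 3.4 (ii) `Prop34Const` and Cor. 3.8 (iii) (first clause, `Λ = ℤ`) at the v2 MODEL OF RECORD, NO binder;
# the Cor. 3.8 datum is inhabited at every rank-one OBJECT

S. Mochizuki, *The étale theta function and its Frobenioid-theoretic manifestations*, Publ. RIMS **45** (2009), Prop. 3.4 (ii)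
p.74 («`L^× ⥲ F₀(Y)`; `div₀(c) = v_L(c)·div(ϖ_L)`»), Cor. 3.8 (iii) p.81, Rmk. 3.3.1 p.73 [cite: MochizukiEtTh2009, Cor 3.8 p.81].

abc-iut cell, layer L2, seat abc-iut-L2-d2 (gen 5); sequel of R587 (a) (`TemperedFrobenioidOfKummerTateTower`, p465559: the v2 model
of record `TateTowerKummer.tower` of abc-iut-L2-t3 carries the rank-one object `pt` and the tempered Frobenioid
`TateTowerKummer.temperedFrobenioid R S := ofRankOneObject rankOneObject hpf R S` of abc-iut-w5-d179's `dm`-generic engine).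
PROOF-ONLY:

* §1 (`dm`-generic, any `P : dm.RankOneObject`) `TemperedFrobenioid.ofRankOneObject_nonDilating`, `nonempty_cor38Hyp_ofRankOneObject`
  (the Cor. 3.8 datum with `Ψ := 𝟭` is INHABITED at every rank-one object; abc-iut-w6-d052's argument), and
  `countable_primes_perfection_Φ_ofRankOneObject` (`hcnt` ⟸ countability of `Prime(Φ₀(Y₀)^pf)`);
* §2 at the v2 model of record: **`TateTowerKummer.prop34Const_ofTower : (DivisorMonoids.ofTower tower).Prop34Const`** — census A1
  (abc-iut-L2-t3's bundle) PROVED at EVERY connected tempered covering `Y : B^temp(Grp)⁰` (clause (a) abc-iut-w6-d058's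
  `exists_inv_mem_fZero`; clause (b) by the `…_action` skeleton lemmas of p465055: `Σ_j [F_j] = div₀(ϖ)`, constant-valued
  equivariant functions on a transitive set, abc-iut-w6-d052's `div₀ b = [Σ F_j]^c`); `countable_primes_perfection_Φ₀_ofTower`
  (abc-iut-w5-d153's `countable_primes_perfection_phiZero`); and **`TateTowerKummer.cor38_iii_temperedFrobenioid (h) : Cor38_iii h`**
  for EVERY Cor. 3.8 datum between the v2 model-of-record Frobenioids, NO binder (this seat's `Λ = ℤ` apex
  `cor38_iii_ofRlfZWeak_of_isFrobenioid_of_countable_of_prop34Const`), with its ∃-form.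

HONEST LABEL: instantiation / consistency certificates at CONSTRUCTED data (`D` one object); refereed pre-IUT material; nothing here
bears on [IUTchIII] Cor. 3.12; no side taken; typed ≠ proved — here proved.
-/

noncomputable section

namespace Literature.AnabelianGeometry.EtaleTheta

open CategoryTheory Opposite Function Literature.AlgebraicGeometry.Frobenioids Literature.AnabelianGeometry.SemiGraphs
  LogDivisorModel LogDivisorModel.GaloisAction LogDivisorModel.TateTower LogDivisorTower

universe u₀ v₀

/-! ## §1 Rank-one objects of any Def. 3.3 (iii) datum: the Cor. 3.8 datum is inhabited; `hcnt` -/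

namespace TemperedFrobenioid

variable {D₀ : Type u₀} [Category.{v₀} D₀] {dm : DivisorMonoids.{u₀, v₀, 0} D₀} (P : dm.RankOneObject)
  (hpf : ∀ Y : D₀ᵒᵖ, IsPerfFactorialCof (dm.Φ₀.obj Y)) (R S : ((Discrete PUnit.{1})ᵒᵖ ⥤ CommMonCat.{0}) → Prop)

/-- `Φ` of a rank-one-object Frobenioid is non-dilating under the endomorphisms of its one-point base (identities).
[cite: MochizukiEtTh2009, Cor 3.8 p.80] -/
theorem ofRankOneObject_nonDilating (B : (Discrete PUnit.{1})ᵒᵖ) (f : B ⟶ B) :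
    treeMonoidVocabWeak.IsNonDilating _ ((ofRankOneObject P hpf R S).Φ.pull f) := by
  have hf : f = 𝟙 B := Quiver.Hom.unop_inj (Subsingleton.elim _ _)
  subst hf
  rw [treeMonoidVocabWeak_isNonDilating]
  have hpull : (ofRankOneObject P hpf R S).Φ.pull (𝟙 B) = MonoidHom.id _ := by
    ext x
    rw [SubMonoidOn.coe_pull, CategoryTheory.Functor.map_id, MonoidHom.id_apply]
    rfl
  rw [hpull]
  exact Example39NV.isNonDilating_id

/-- **The Cor. 3.8 datum is inhabited between two rank-one-object Frobenioids over the SAME data** (`Ψ := 𝟭`).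
[cite: MochizukiEtTh2009, Cor 3.8 p.80] -/
theorem nonempty_cor38Hyp_ofRankOneObject :
    Nonempty (Cor38Hyp (ofRankOneObject P hpf R S) (ofRankOneObject P hpf R S)) :=
  ⟨{ Ψ := CategoryTheory.Equivalence.refl
     fsmff := ⟨PadicFrd.isOfFSMType_discretePUnit.isOfFSMFFType, PadicFrd.isOfFSMType_discretePUnit.isOfFSMFFType⟩
     nonDilating := ⟨ofRankOneObject_nonDilating P hpf R S, ofRankOneObject_nonDilating P hpf R S⟩ }⟩

/-- **`hcnt` at a rank-one object**: `Prime(Φ(B)^pf)` is countable as soon as `Prime(Φ₀(Y₀)^pf)` is (`Φ(B) = ι(Φ₀(Y₀)^pf)`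
definitionally, `ι` injective on `Φ₀^pf`; abc-iut-w6-d052's argument). [cite: MochizukiEtTh2009, Ex 3.9 p.84] -/
theorem countable_primes_perfection_Φ_ofRankOneObject [Countable (Primes (Perfection (dm.Φ₀.obj (op P.Y₀))))]
    (B : (Discrete PUnit.{1})ᵒᵖ) : Countable (Primes (Perfection ↥((ofRankOneObject P hpf R S).Φ.carrier B))) := by
  have hM := hpf (op P.Y₀)
  haveI : Countable (Primes ↥(MonoidHom.mrange hM.weak.toRealification)) :=
    countable_primes_of_mulEquiv (MulEquiv.ofBijective _ (PfImageWeak.mrangeRestrict_toRealification_bijective hM.weak))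
  exact (PfImageWeak.isPerfFactorialCof_mrange_toRealification hM).weak.countable_primes_perfection

end TemperedFrobenioid

/-! ## §2 The v2 model of record -/

namespace TateTowerKummer

open TateTowerFrd

/-- **Clause (b) of `Prop34Const` at every connected tempered covering of the Kummer–Tate tower**: `d := Σ_j [F_j] ∈ Φ₀(Y)` is
non-cuspidal, `≠ 0`, equals `div₀(ϖ)`, and `div₀(b) = c • d` for every `b = ϖ^c ∈ F₀(Y)` (a constant-valued equivariant function on a
transitive `Grp`-set is constant). [cite: MochizukiEtTh2009, Prop 3.4 p.74] -/
theorem exists_specialFibre_phiZero (Y : ConnectedPart (BTemp Grp)) :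
    ∃ d ∈ act.ncspZero (gset Y), d ≠ 1 ∧
      (∃ ϖ ∈ act.fZero (gset Y), act.divZeroHom (gset Y) ϖ = Algebra.GrothendieckGroup.of d) ∧
      ∀ b ∈ act.fZero (gset Y), ∃ n : ℤ, act.divZeroHom (gset Y) b = Algebra.GrothendieckGroup.of d ^ n := by
  obtain ⟨⟨s₀⟩, htrans⟩ := (BTemp.isConnectedObj_iff Y.obj).mp Y.property
  let d : act.phiZero (gset Y) := ⟨_, constDIV_one_mem_phiZero_action act (gset Y) act_actDIV_constDIV⟩
  have hd : ∀ s, d.1 s = (constDIV 1 : TateTower.model.DIV) := fun _ => rfl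
  refine ⟨d, fun _ => trivial, fun h => constDIV_one_ne_one ((hd s₀).symm.trans (by rw [h]; rfl)), ?_, ?_⟩
  · refine ⟨⟨_, const_mem_bZero_action act (gset Y) (fun g => Multiplicative.toAdd g.1) act_actFn_apply 1⟩,
      fun _ => ofAdd_const_mem_const 1, ?_⟩
    have h := divZero_eq_zpow_of_forall_eq_action act (gset Y) d hd
      ⟨_, const_mem_bZero_action act (gset Y) (fun g => Multiplicative.toAdd g.1) act_actFn_apply 1⟩ 1 (fun _ => rfl)
    rw [zpow_one] at h
    exact h
  · intro b hb
    obtain ⟨c, hc⟩ := exists_eq_ofAdd_of_mem_const (hb s₀)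
    exact ⟨c, divZero_eq_zpow_of_forall_eq_action act (gset Y) d hd b c
      (apply_eq_of_apply_eq_const_action act (gset Y) (fun g => Multiplicative.toAdd g.1) act_actFn_apply htrans s₀ b hc)⟩

/-- **[EtTh] Prop. 3.4 (ii), abc-iut-L2-t3's bundle `Prop34Const` (census A1), HOLDS at the v2 MODEL OF RECORD** — the Kummer–Tate
tower's Def. 3.3 (iii) data with covering-indexed `Mero`, at every connected tempered covering. [cite: MochizukiEtTh2009, Prop 3.4 p.74] -/
theorem prop34Const_ofTower : (DivisorMonoids.ofTower tower).Prop34Const where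
  inv_mem_F₀ Y b hb := exists_inv_mem_fZero act (gset Y.unop) b hb
  exists_specialFibre Y := exists_specialFibre_phiZero Y.unop

/-- **`Prime(Φ₀(Y)^pf)` is countable at every connected tempered covering of the v2 model of record** (countable orbit,
no cusps, components `ℤ`; abc-iut-w5-d153's `countable_primes_perfection_phiZero`). [cite: MochizukiEtTh2009, Rmk 3.3.1 p.73] -/
theorem countable_primes_perfection_Φ₀_ofTower (Y : (ConnectedPart (BTemp Grp))ᵒᵖ) :
    Countable (Primes (Perfection ↥((DivisorMonoids.ofTower tower).Φ₀.obj Y))) := by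
  haveI : Countable (gset Y.unop).V := Y.unop.obj.property.1
  haveI : Countable TateTower.model.Cusp := show Countable PEmpty.{1} from inferInstance
  haveI : Countable TateTower.model.Comp := show Countable ℤ from inferInstance
  exact countable_primes_perfection_phiZero act (gset Y.unop)

variable (R S R' S' : ((Discrete PUnit.{1})ᵒᵖ ⥤ CommMonCat.{0}) → Prop)

/-- `hcnt` at the v2 model-of-record Frobenioid. [cite: MochizukiEtTh2009, Ex 3.9 p.84] -/
theorem countable_primes_perfection_Φ_temperedFrobenioid (B : (Discrete PUnit.{1})ᵒᵖ) :
    Countable (Primes (Perfection ↥((temperedFrobenioid R S).Φ.carrier B))) := by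
  haveI := countable_primes_perfection_Φ₀_ofTower (op rankOneObject.Y₀)
  exact TemperedFrobenioid.countable_primes_perfection_Φ_ofRankOneObject rankOneObject hpf R S B

/-- **[EtTh] Cor. 3.8 (iii), first clause (`Λ = ℤ`), at the v2 MODEL OF RECORD with NO binder**: for EVERY Cor. 3.8 datum `h` between
the Kummer–Tate tower's tempered Frobenioids, `Cor38_iii h` — this seat's apex `cor38_iii_ofRlfZWeak_of_isFrobenioid_of_countable_of_prop34Const`
with `hcnt` (`countable_primes_perfection_Φ_temperedFrobenioid`), `Prop34Const` (`prop34Const_ofTower`) and «`C` is a Frobenioid»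
(`isFrobenioid_temperedFrobenioid`) all THEOREMS. [cite: MochizukiEtTh2009, Cor 3.8 p.81] -/
theorem cor38_iii_temperedFrobenioid (h : Cor38Hyp (temperedFrobenioid R S) (temperedFrobenioid R' S')) : Cor38_iii h :=
  cor38_iii_ofRlfZWeak_of_isFrobenioid_of_countable_of_prop34Const h
    (countable_primes_perfection_Φ_temperedFrobenioid R S) (countable_primes_perfection_Φ_temperedFrobenioid R' S')
    prop34Const_ofTower prop34Const_ofTower (isFrobenioid_temperedFrobenioid R S) (isFrobenioid_temperedFrobenioid R' S')

/-- **∃-form, no hypothesis**: `Cor38_iii` is INHABITED at the v2 model of record (`Ψ := 𝟭`). [cite: MochizukiEtTh2009, Cor 3.8 p.81] -/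
theorem exists_cor38Hyp_cor38_iii_temperedFrobenioid :
    ∃ h : Cor38Hyp (temperedFrobenioid R S) (temperedFrobenioid R S), Cor38_iii h := by
  obtain ⟨h⟩ := TemperedFrobenioid.nonempty_cor38Hyp_ofRankOneObject rankOneObject hpf R S
  exact ⟨h, cor38_iii_temperedFrobenioid R S R S h⟩

end TateTowerKummer

end Literature.AnabelianGeometry.EtaleTheta

end
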